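import Summits.QuantumFields.YangMills.Theorems.FluctuationComparisonRegPrIntLS2BetaChartReadCurvedOfPlaqSmall
import Summits.QuantumFields.YangMills.Theorems.BalabanUVNodesN18ThreeBlockBoxGauge
import HarnessLib

/-!
# S2β · (β-3)′ ∕ rows v2 — C₇a «THE COVARIANT EDITION, ONE PLAQUETTE» (HAZARD «SRC-VOL-R», architect px17 g23 23:46:52Z (q2); px13's answer 23:48:06Z): the order-2 remainder
# letter with NO bond size `β` and NO `κ` — the oscillation is read in the FOUR-BLOCK axial gauge `h` of the background (one gauge per coarse plaquette), so
# `‖rem‖ ≤ R′ := 8B·O²∕(a − M)² + 32B·O·M∕a² + (ℓM)³ + 8·(67ℓ·((d−1)·3L·δ))·M²∕a²`, `B = 54ℓ(e^a − 1)`; the only chord² pieces left are `O·M` and `O²` with `O` COVARIANT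

Cell `ym3-torus` (YM ladder rung R3 = continuum `SU(2)` Yang–Mills on the three-torus at fixed lattice data — a RUNG: NOT d = 4, NOT infinite volume, NOT a mass gap,
NOT Clay).  Width seat `ym3-torus-px13` (gen 28); crux `stmt-QuantumFields-20520`, LINE g18-1 S2β, pairing lane; (SCT″-c)₁; RULING «SRC-VOL» (R-b)∕(R-e)∕(R-f) and «SRC-VOL (3)»
(HAZARD «SRC-VOL-R»: the remainder's chord-class pieces need co-level-decaying coefficients; (q2) «is `κ = d·2L·β`'s `β` a BOND size?» — YES in C₅∕C₆, σ-class; THIS FILE removes it).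
HOW: C₅ ✓p836326 paid `β` only to convert the GAUGED oscillation into the raw one (door (γ)).  Here the oscillation letter is COVARIANT from the start: `h` = lit
✓`T4AxialGaugeSmallField.axialGauge U₀ lo hi` on the box `[emb y − h, emb y + h + L·e_μ + L·e_ν + 1]` containing the FOUR corner blocks of the coarse plaquette `(y; μ, ν)` (so ONE
gauge serves all four bonds of `∂(y; μ, ν)`), `PlaqSmall δ U₀ ⟹ ‖(h•U₀)(b) − 1‖ ≤ (d−1)·3L·δ` on the corner bonds (lit ★`dist1_gaugeAct_axialGauge_le_of_mem_boxBonds`, `3L+1` sites per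
direction, no wrap by `3L < 2L² ≤ sitesPerDir j`), and the chain (D1-loc) locality → C₃ ✓`norm_chartRead_sub_fderiv_gaugeAct` (remainder norm gauge invariant) → C₂
✓`norm_chartRead_sub_fderiv_le_curved_osc` at `(h•U₀, Ad_h X̃)` runs on the COMPLETED corner truncation `X̃ = X` on the corners, `Ad_{h⁻¹}(Aref∘dir)` elsewhere (so `Ad_h X̃ = Aref∘dir`
off the corners and `‖X̃‖ ≤ M`).  The rows∕tower editions are C₇b `…CoarseCurlRowsCovariant`.
`--kind proof --supports stmt-QuantumFields-20520 --as helper`, count-neutral, DEFINITION-FREE (0 `def`, 0 `instance`, 0 `notation`, 0 `sorry`, default heartbeats); generic `P : Params`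
(`j + 2 ≤ m + K`), `SU(N)`.

WHAT IS PROVED (sorry-free; `ℓ = (d+2)L`, `h = (L−1)∕2`).
§1 `inBox_rel_of_corner` (a site of the four corner blocks has `rel (emb y) ·` in `[−h, h]ᵈ + [0, L]e_μ + [0, L]e_ν`; N18 ✓`rel_emb_blockSite(_shift)(_shift_shift)`), ★`mem_boxBonds_of_corner`,
   `hi_le_lo_add_corner` (`hi ≤ lo + 3L`), `three_mul_lt_sitesPerDir`, ★★`norm_coe_gaugeAct_axialGauge_sub_one_le_corner` (**`‖(h•U₀)(b) − 1‖ ≤ (d−1)·3L·δ`** on the corner bonds from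
   `PlaqSmall δ` alone).
§2 ★★★**`norm_remainder_le_on_four_cov`** — hypotheses: loop guard `∀ c i, dist1 (loopHol U₀ c i) ≤ α`, `4α ≤ ρ ≤ innerRadius`, `0 < ρ`; `PlaqSmall δ U₀`, `0 ≤ δ`,
   `100ℓ·((d−1)·3L·δ) ≤ ρ`; `j + 2 ≤ m + K`; window `0 < a`, `100ℓ(e^a − 1) ≤ ρ`, `8M ≤ a`, `8·O ≤ a`; free `Aref : Fin d → 𝔰𝔲(N)` with `‖Aref‖ ≤ M`, `0 ≤ O`; LOCAL letters on the bonds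
   issuing from the four corner blocks: `‖X b‖ ≤ M` and the COVARIANT oscillation **`‖h(b₋)·↑X_b·h(b₋)⋆ − ↑Aref(b.dir)‖ ≤ O`**.  Conclusion, on each of the FOUR bonds `c` of `∂(y; μ, ν)`:
   **`‖↑(ψ_{U₀}(X)c) − ↑((Dψ_{U₀}(0)X)c)‖ ≤ 8B·O²∕(a − M)² + 32B·O·M∕a² + (ℓM)³ + 8·(67ℓ·((d−1)·3L·δ))·M²∕a²`** — NO bond size, NO `κ`, NO gauge LETTER (the gauge is a written-out term of `U₀`).
§3 ★`R'_mono` — «R′-MONO»: monotone in `(O, M, δ)` on `0 ≤ O`, `0 ≤ M < a`, `0 ≤ δ` (read-cell sups in one `exact`, RULING «SRC-VOL» (R-e)∕(R-f)).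
WHAT IS LEFT (HAZARD «SRC-VOL-R» after this file) = (q1) in covariant form, px12's: is the read-cell COVARIANT oscillation `O` (differences after the background's parallel transport
`h(b₋)⁻¹h(b′₋)` along the box comb) bounded by (BKG∕ρ)-class quantities?  The `δ·M²` piece is plaquette-class × chord²; the cubic is summable; `O·M`, `O²` wait on (q1).

HONEST.  Composition of landed files (C₂, C₃, lit `T4AxialGaugeSmallField`, N18 box lemmas, (D1-loc)); nothing of Bałaban's analysis is asserted or proved ([Balaban1985Averaging]
pp.24–25 «|V₀,b − 1| < |b₋ − y|α₀» in the axial gauge, Prop. 3∕4 are SOURCES); (q1), budgets, (E5), G4-ii, (ST‴), (SCT″-c)₁₂₃, LOC‴, GAP♯∘ (`stub_uniformFibreGapOrbit`, registry 3732b7df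
UNTOUCHED, 0∕5), the five REGISTERED stubs, S2β, crux 20520, 19936, 19200, `YM3TorusSU2` — NOT proved; no summit statement is proved by a helper; rung R3 = SU(2) YM₃ on T³ at fixed
lattice data — NOT d = 4, NOT infinite volume, NOT a mass gap, NOT Clay; the Yang–Mills mass gap is NOT proved.  Axioms standard.

References: [Balaban1985Averaging] T. Bałaban, CMP **98** (1985) 17–51, p.19, pp.24–25, Prop. 3 (121)–(125) p.36, Prop. 4 (128)–(135) pp.37–38, (148)–(149) p.40; [Balaban1985UV3]
CMP **102** (1985) 255–275, (27) p.263; [Balaban1987RG1] CMP **109** (1987) 249–301, (0.1)–(0.4) pp.251–253.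
-/

set_option autoImplicit false

noncomputable section

open scoped Matrix.Norms.L2Operator Topology
open Filter Set Function Metric

namespace Summit.QuantumFields.YangMills.Theorems.FluctuationComparisonRegPrIntLS2BetaCoarseCurlRemainderCovariant

open Literature.MathematicalPhysics.QuantumFieldTheory.Balaban1983to89
open Literature.MathematicalPhysics.QuantumFieldTheory.Balaban1983to89.HaarExponentialChart
open Literature.MathematicalPhysics.QuantumFieldTheory.Balaban1983to89.HaarExponentialChart.IsChartRep
open Literature.MathematicalPhysics.QuantumFieldTheory.Balaban1983to89.BlockAveraging (Small Idx avgFun loopHol off corr off_bounds)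
open Literature.MathematicalPhysics.QuantumFieldTheory.Balaban1983to89.ExpMeanLog (eml expMeanLogSU deltaSU deltaSU_pos)
open Literature.MathematicalPhysics.QuantumFieldTheory.Balaban1983to89.Node00
open Literature.MathematicalPhysics.QuantumFieldTheory.Balaban1983to89.T4Continuum (walk holAt LStep loopWord Letter)
open Literature.MathematicalPhysics.QuantumFieldTheory.Balaban1983to89.BlockAveragingEMLProp2 (shift_shift_comm)
open Literature.MathematicalPhysics.QuantumFieldTheory.Balaban1983to89.B10Eq27TorusAxialLog (rel transl transl_apply transl_rel)
open Literature.MathematicalPhysics.QuantumFieldTheory.Balaban1983to89.B7Prop1Local (InBox)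
open Literature.MathematicalPhysics.QuantumFieldTheory.Balaban1983to89.B7Prop1Explicit (e e_apply)
open Literature.MathematicalPhysics.QuantumFieldTheory.Balaban1983to89.T4AxialGaugeSmallField (castSite castSite_apply boxBonds boxPlaqs axialGauge dist1_gaugeAct_axialGauge_le_of_mem_boxBonds)
open Literature.MathematicalPhysics.QuantumFieldTheory.Balaban1983to89.BlockAveragingSectionQsstar (eq_blockSite_blockEquiv)
open Summit.QuantumFields.YangMills.BalabanUVNodes.N09ChartReadAveragingSmooth
open Summit.QuantumFields.YangMills.Theorems.FluctuationComparisonRegPrIntLS2BetaChartReadCplxExtension (innerRadius_le_deltaSU)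
open Summit.QuantumFields.YangMills.Theorems.FluctuationComparisonRegPrIntLS2BetaCovWalkSumStokes (norm_coe_conj_le)
open Summit.QuantumFields.YangMills.Theorems.FluctuationComparisonRegPrIntLS2BetaChartReadDerivLocal (chartRead_apply_local fderiv_chartRead_apply_local)
open Summit.QuantumFields.YangMills.Theorems.FluctuationComparisonRegPrIntLS2BetaChartReadBkgLipschitz (norm_chartRead_sub_fderiv_le_curved_osc)
open Summit.QuantumFields.YangMills.Theorems.FluctuationComparisonRegPrIntLS2BetaChartReadGaugeCovariance
open Summit.QuantumFields.YangMills.Theorems.FluctuationComparisonRegPrIntLS2BetaChartReadCurvedOfPlaqSmall (two_mul_lt_sitesPerDir)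
open YMDAG.N18.TransportOfRecord (rel_emb_blockSite rel_emb_blockSite_shift rel_emb_blockSite_shift_shift two_mul_sq_le_sitesPerDir)

variable {P : Params} {j : ℕ} {N : ℕ} [NeZero N]

/-! ## §1 The four corner blocks of a coarse plaquette lie in ONE non-wrapping integer box `[emb y − h, emb y + h + L·e_μ + L·e_ν + 1]` (`h = (L−1)∕2`, `j + 2 ≤ m + K`) -/

section Box

omit [NeZero N] in
/-- A site of `B(y) ∪ B(y+e_μ) ∪ B(y+e_ν) ∪ B(y+e_μ+e_ν)` has its relative position (w.r.t. `emb y`) in the box `[−h, h]ᵈ + [0, L]e_μ + [0, L]e_ν`.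
[cite: Balaban1987RG1, (0.3)-(0.4) pp.252-253] -/
theorem inBox_rel_of_corner (hj : j + 1 ≤ P.m + P.K) (hj2 : j + 2 ≤ P.m + P.K) (y : Site P (j + 1)) (μ ν : Fin P.d) {x : Site P j}
    (hx : blockOf x = y ∨ blockOf x = y.shift μ ∨ blockOf x = y.shift ν ∨ blockOf x = (y.shift μ).shift ν) :
    InBox (fun _ => -(((P.L - 1) / 2 : ℕ) : ℤ)) (fun κ => ((if κ = μ then (P.L : ℤ) else 0) + (if κ = ν then (P.L : ℤ) else 0)) + (((P.L - 1) / 2 : ℕ) : ℤ)) (rel (emb y) x) := by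
  obtain ⟨r, hr⟩ : ∃ r : Fin P.d → Fin P.L, x = Site.blockSite (blockOf x) r := ⟨_, eq_blockSite_blockEquiv hj x⟩
  intro κ
  have hb := off_bounds r κ
  have hL0 : (0 : ℤ) ≤ (P.L : ℤ) := by positivity
  have hLμ : (0 : ℤ) ≤ (if κ = μ then (P.L : ℤ) else 0) := by split_ifs <;> linarith
  have hLν : (0 : ℤ) ≤ (if κ = ν then (P.L : ℤ) else 0) := by split_ifs <;> linarith
  rcases hx with h | h | h | h <;> rw [h] at hr <;> rw [hr]
  · rw [rel_emb_blockSite hj]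
    dsimp only
    constructor <;> linarith [hb.1, hb.2]
  · rw [rel_emb_blockSite_shift hj2, Pi.add_apply, Pi.smul_apply, e_apply, smul_eq_mul]
    dsimp only
    have hmul : (P.L : ℤ) * (if κ = μ then (1 : ℤ) else 0) = (if κ = μ then (P.L : ℤ) else 0) := by split_ifs <;> simp
    rw [hmul]
    constructor <;> linarith [hb.1, hb.2]
  · rw [rel_emb_blockSite_shift hj2, Pi.add_apply, Pi.smul_apply, e_apply, smul_eq_mul]
    dsimp only
    have hmul : (P.L : ℤ) * (if κ = ν then (1 : ℤ) else 0) = (if κ = ν then (P.L : ℤ) else 0) := by split_ifs <;> simp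
    rw [hmul]
    constructor <;> linarith [hb.1, hb.2]
  · rw [rel_emb_blockSite_shift_shift hj2, Pi.add_apply, Pi.add_apply, Pi.smul_apply, Pi.smul_apply, e_apply, e_apply, smul_eq_mul, smul_eq_mul]
    dsimp only
    have hmul : (P.L : ℤ) * (if κ = μ then (1 : ℤ) else 0) = (if κ = μ then (P.L : ℤ) else 0) := by split_ifs <;> simp
    have hmul' : (P.L : ℤ) * (if κ = ν then (1 : ℤ) else 0) = (if κ = ν then (P.L : ℤ) else 0) := by split_ifs <;> simp
    rw [hmul, hmul']
    constructor <;> linarith [hb.1, hb.2]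

omit [NeZero N] in
/-- ★ **THE CORNER-BLOCK BONDS ARE BOX BONDS**: every bond issuing from the four corner blocks of `(y; μ, ν)` is `⟨castSite x, κ⟩` with `lo ≤ x`, `x + e_κ ≤ hi` for the integer box
`lo = emb y − h`, `hi = emb y + h + L·e_μ + L·e_ν + 1`. [cite: Balaban1987RG1, (0.1), (0.3) pp.251-252] -/
theorem mem_boxBonds_of_corner (hj : j + 1 ≤ P.m + P.K) (hj2 : j + 2 ≤ P.m + P.K) (y : Site P (j + 1)) (μ ν : Fin P.d) (b : PBond P j)
    (hb : (blockOf b.src = y ∨ blockOf b.src = y.shift μ ∨ blockOf b.src = y.shift ν ∨ blockOf b.src = (y.shift μ).shift ν)) :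
    b ∈ boxBonds (fun κ : Fin P.d => (((emb y κ).val : ℕ) : ℤ) - (((P.L - 1) / 2 : ℕ) : ℤ)) (fun κ : Fin P.d => (((emb y κ).val : ℕ) : ℤ) + (((if κ = μ then (P.L : ℤ) else 0) + (if κ = ν then (P.L : ℤ) else 0)) + (((P.L - 1) / 2 : ℕ) : ℤ)) + 1) := by
  have hbox := inBox_rel_of_corner hj hj2 y μ ν hb
  refine ⟨fun κ => (((emb y κ).val : ℕ) : ℤ) + rel (emb y) b.src κ, ?_, ?_, ?_⟩
  · intro κ
    have h1 := (hbox κ).1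
    dsimp only at h1 ⊢
    linarith
  · intro κ
    have h2 := (hbox κ).2
    have hL0 : (0 : ℤ) ≤ (P.L : ℤ) := by positivity
    simp only [Pi.add_apply, B7Prop1Explicit.e_apply] at h2 ⊢
    split_ifs at h2 ⊢ <;> linarith
  · funext κ
    rw [castSite_apply, Int.cast_add, Int.cast_natCast, ZMod.natCast_zmod_val, ← transl_apply, transl_rel]

omit [NeZero N] in
/-- The box has `3L + 1` sites per direction at most (`hi ≤ lo + 3L`). [folklore] -/
theorem hi_le_lo_add_corner (y : Site P (j + 1)) (μ ν κ : Fin P.d) :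
    (fun κ : Fin P.d => (((emb y κ).val : ℕ) : ℤ) + (((if κ = μ then (P.L : ℤ) else 0) + (if κ = ν then (P.L : ℤ) else 0)) + (((P.L - 1) / 2 : ℕ) : ℤ)) + 1) κ ≤ (fun κ : Fin P.d => (((emb y κ).val : ℕ) : ℤ) - (((P.L - 1) / 2 : ℕ) : ℤ)) κ + ((3 * P.L : ℕ) : ℤ) := by
  have hL : (2 : ℤ) * (((P.L - 1) / 2 : ℕ) : ℤ) + 1 = P.L := by exact_mod_cast AveragingRT.two_mul_half_add_one P
  have h3L : ((3 * P.L : ℕ) : ℤ) = 3 * (P.L : ℤ) := by norm_num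
  have hL0 : (0 : ℤ) ≤ (P.L : ℤ) := by positivity
  rw [h3L]
  dsimp only
  split_ifs <;> linarith

omit [NeZero N] in
/-- The box does not wrap: `3L < sitesPerDir j` when `j + 2 ≤ m + K` (`3L < 2L² ≤ sitesPerDir j`, `L ≥ 2`). [folklore] -/
theorem three_mul_lt_sitesPerDir (hj2 : j + 2 ≤ P.m + P.K) : 3 * P.L < P.sitesPerDir j := by
  have h := two_mul_sq_le_sitesPerDir (P := P) hj2
  have hL : 2 ≤ P.L := P.hL.2
  have : 3 * P.L < 2 * P.L ^ 2 := by nlinarith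
  omega

/-- ★★ **THE FOUR-BLOCK AXIAL-GAUGE COPY OF A PLAQUETTE-SMALL BACKGROUND IS `(d−1)·3L·δ`-CLOSE TO `1` ON THE BONDS ISSUING FROM THE FOUR CORNER BLOCKS.**
[cite: Balaban1985Averaging, pp.24-25; Balaban1985UV3, (27) p.263] -/
theorem norm_coe_gaugeAct_axialGauge_sub_one_le_corner (hj : j + 1 ≤ P.m + P.K) (hj2 : j + 2 ≤ P.m + P.K) (U₀ : GaugeField P j (SU N)) {δ : ℝ} (hδ : 0 ≤ δ)
    (hU : PlaqSmall δ U₀) (y : Site P (j + 1)) (μ ν : Fin P.d) (b : PBond P j) (hb : (blockOf b.src = y ∨ blockOf b.src = y.shift μ ∨ blockOf b.src = y.shift ν ∨ blockOf b.src = (y.shift μ).shift ν)) :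
    ‖((GaugeField.gaugeAct (axialGauge U₀ (fun κ : Fin P.d => (((emb y κ).val : ℕ) : ℤ) - (((P.L - 1) / 2 : ℕ) : ℤ)) (fun κ : Fin P.d => (((emb y κ).val : ℕ) : ℤ) + (((if κ = μ then (P.L : ℤ) else 0) + (if κ = ν then (P.L : ℤ) else 0)) + (((P.L - 1) / 2 : ℕ) : ℤ)) + 1)) U₀ b : SU N) : Matrix (Fin N) (Fin N) ℂ) - 1‖ ≤ ((P.d - 1 : ℕ) : ℝ) * ((3 * P.L : ℕ) : ℝ) * δ := by
  have hS₀ : boxPlaqs (fun κ : Fin P.d => (((emb y κ).val : ℕ) : ℤ) - (((P.L - 1) / 2 : ℕ) : ℤ)) (fun κ : Fin P.d => (((emb y κ).val : ℕ) : ℤ) + (((if κ = μ then (P.L : ℤ) else 0) + (if κ = ν then (P.L : ℤ) else 0)) + (((P.L - 1) / 2 : ℕ) : ℤ)) + 1) ⊆ (Set.univ : Set (Plaq P j)) := Set.subset_univ _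
  have hU' : PlaqSmallOn (Set.univ : Set (Plaq P j)) δ U₀ := fun p _ => hU p
  exact dist1_gaugeAct_axialGauge_le_of_mem_boxBonds U₀ hS₀ hU' hδ (hi_le_lo_add_corner (P := P) y μ ν) (three_mul_lt_sitesPerDir (P := P) hj2)
    (mem_boxBonds_of_corner hj hj2 y μ ν b hb)

end Box

/-! ## §2 ★★★ One coarse plaquette, COVARIANT: the remainder on the four bonds of `∂(y; μ, ν)` from local sizes and the oscillation READ IN THE FOUR-BLOCK AXIAL GAUGE — no bond size -/

section OnePlaquette

/-- ★★★ **R-DISCHARGE, COVARIANT, ONE PLAQUETTE.**  Background `U₀` at level `j` (`j + 2 ≤ m + K`): loop guard `∀ c i, dist1 (loopHol U₀ c i) ≤ α`, `4α ≤ ρ ≤ innerRadius`, `0 < ρ`;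
`PlaqSmall δ U₀` with `100ℓ·((d−1)·3L·δ) ≤ ρ` — and NOTHING about its bond variables.  `h` = the FOUR-BLOCK axial gauge of `U₀` on the box of `(y; μ, ν)` (lit ✓`T4AxialGaugeSmallField.axialGauge`,
written out).  Datum `X`, free direction data `Aref : Fin d → 𝔰𝔲(N)` with `‖Aref‖ ≤ M`; LOCAL letters on the bonds issuing from the four corner blocks: `‖X b‖ ≤ M` and the COVARIANT oscillation
`‖h(b₋)·↑X_b·h(b₋)⋆ − Aref(b.dir)‖ ≤ O` (`0 ≤ O`); window `0 < a`, `100ℓ(e^a − 1) ≤ ρ`, `8M ≤ a`, `8·O ≤ a`.  Then on each of the FOUR bonds `c` of `∂(y; μ, ν)`: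
`‖↑(ψ_{U₀}(X)c) − ↑((Dψ_{U₀}(0)X)c)‖ ≤ 8B·O²∕(a − M)² + 32B·O·M∕a² + (ℓM)³ + 8·(67ℓ·((d−1)·3L·δ))·M²∕a²`, `B = 54ℓ(e^a − 1)` — NO `κ`, NO bond size
((D1-loc) locality at the completed corner truncation `X̃ = X` on the corners, `Ad_{h⁻¹}Aref∘dir` elsewhere; C₃ gauge invariance of the remainder norm; C₂ at `(h•U₀, Ad_h X̃)`; §1).
[cite: Balaban1985Averaging, p.19, pp.24-25, Prop. 3 (121)-(125) p.36, Prop. 4 (148)-(149) p.40; Balaban1987RG1, (0.3)-(0.4) pp.252-253] -/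
theorem norm_remainder_le_on_four_cov (hj2 : j + 2 ≤ P.m + P.K) (U₀ : GaugeField P j (SU N)) {α ρ : ℝ} (hρ0 : 0 < ρ)
    (hρ : ρ ≤ innerRadius (specialUnitaryLogChart (Fin N))) (hα : ∀ c i, dist1 (loopHol U₀ c i) ≤ α) (hα4 : 4 * α ≤ ρ)
    {δ : ℝ} (hδ : 0 ≤ δ) (hU : PlaqSmall δ U₀) (hκℓ : 100 * ((((P.d + 2) * P.L : ℕ) : ℝ) * (((P.d - 1 : ℕ) : ℝ) * ((3 * P.L : ℕ) : ℝ) * δ)) ≤ ρ)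
    {a : ℝ} (ha0 : 0 < a) (ha : 100 * ((((P.d + 2) * P.L : ℕ) : ℝ) * (Real.exp a - 1)) ≤ ρ)
    (X : PBond P j → (specialUnitaryLogChart (Fin N)).lie) (y : Site P (j + 1)) {μ ν : Fin P.d} (Aref : Fin P.d → (specialUnitaryLogChart (Fin N)).lie) {M O : ℝ} (hO0 : 0 ≤ O)
    (hAM : ‖Aref‖ ≤ M) (hMa : 8 * M ≤ a) (hOa : 8 * O ≤ a)
    (hXM : ∀ b : PBond P j, (blockOf b.src = y ∨ blockOf b.src = y.shift μ ∨ blockOf b.src = y.shift ν ∨ blockOf b.src = (y.shift μ).shift ν) → ‖X b‖ ≤ M)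
    (hXO : ∀ b : PBond P j, (blockOf b.src = y ∨ blockOf b.src = y.shift μ ∨ blockOf b.src = y.shift ν ∨ blockOf b.src = (y.shift μ).shift ν) →
      ‖(((T4AxialGaugeSmallField.axialGauge U₀ (fun κ : Fin P.d => (((emb y κ).val : ℕ) : ℤ) - (((P.L - 1) / 2 : ℕ) : ℤ)) (fun κ : Fin P.d => (((emb y κ).val : ℕ) : ℤ) + (((if κ = μ then (P.L : ℤ) else 0) + (if κ = ν then (P.L : ℤ) else 0)) + (((P.L - 1) / 2 : ℕ) : ℤ)) + 1)) b.src : SU N) : Matrix (Fin N) (Fin N) ℂ) * ((X b : (specialUnitaryLogChart (Fin N)).lie) : Matrix (Fin N) (Fin N) ℂ) * star (((T4AxialGaugeSmallField.axialGauge U₀ (fun κ : Fin P.d => (((emb y κ).val : ℕ) : ℤ) - (((P.L - 1) / 2 : ℕ) : ℤ)) (fun κ : Fin P.d => (((emb y κ).val : ℕ) : ℤ) + (((if κ = μ then (P.L : ℤ) else 0) + (if κ = ν then (P.L : ℤ) else 0)) + (((P.L - 1) / 2 : ℕ) : ℤ)) + 1)) b.src : SU N) : Matrix (Fin N) (Fin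 N) ℂ) - ((Aref b.dir : (specialUnitaryLogChart (Fin N)).lie) : Matrix (Fin N) (Fin N) ℂ)‖ ≤ O)
    (c : PBond P (j + 1)) (hc : (c = ⟨y, μ⟩ ∨ c = ⟨y.shift μ, ν⟩ ∨ c = ⟨y.shift ν, μ⟩ ∨ c = ⟨y, ν⟩)) :
    ‖(((isChartRep_specialUnitaryGroup (n := Fin N)).logChart (avgFun (expMeanLogSU (n := Fin N)) (fun b => (isChartRep_specialUnitaryGroup (n := Fin N)).expChart (X b) * U₀ b) c * (avgFun (expMeanLogSU (n := Fin N)) U₀ c)⁻¹) : (specialUnitaryLogChart (Fin N)).lie) : Matrix (Fin N) (Fin N) ℂ) -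
        (((fderiv ℝ (fun (A : PBond P j → (specialUnitaryLogChart (Fin N)).lie) (c : PBond P (j + 1)) => (isChartRep_specialUnitaryGroup (n := Fin N)).logChart (avgFun (expMeanLogSU (n := Fin N)) (fun b => (isChartRep_specialUnitaryGroup (n := Fin N)).expChart (A b) * U₀ b) c * (avgFun (expMeanLogSU (n := Fin N)) U₀ c)⁻¹)) 0 X) c : (specialUnitaryLogChart (Fin N)).lie) : Matrix (Fin N) (Fin N) ℂ)‖ ≤
      8 * (54 * ((((P.d + 2) * P.L : ℕ) : ℝ) * (Real.exp a - 1))) * O ^ 2 / (a - M) ^ 2 +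
        32 * (54 * ((((P.d + 2) * P.L : ℕ) : ℝ) * (Real.exp a - 1))) * O * M / a ^ 2 +
        ((((P.d + 2) * P.L : ℕ) : ℝ) * M) ^ 3 + 8 * (67 * ((((P.d + 2) * P.L : ℕ) : ℝ) * (((P.d - 1 : ℕ) : ℝ) * ((3 * P.L : ℕ) : ℝ) * δ))) * M ^ 2 / a ^ 2 := by
  classical
  have hj : j + 1 ≤ P.m + P.K := by omega
  have hM0 : 0 ≤ M := (norm_nonneg _).trans hAM
  set h : GaugeTransf P j (SU N) := (T4AxialGaugeSmallField.axialGauge U₀ (fun κ : Fin P.d => (((emb y κ).val : ℕ) : ℤ) - (((P.L - 1) / 2 : ℕ) : ℤ)) (fun κ : Fin P.d => (((emb y κ).val : ℕ) : ℤ) + (((if κ = μ then (P.L : ℤ) else 0) + (if κ = ν then (P.L : ℤ) else 0)) + (((P.L - 1) / 2 : ℕ) : ℤ)) + 1)) with hh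
  -- the corner truncation, completed by `Ad_{h⁻¹} Aref∘dir` outside
  set Xt : PBond P j → (specialUnitaryLogChart (Fin N)).lie := fun b => if (blockOf b.src = y ∨ blockOf b.src = y.shift μ ∨ blockOf b.src = y.shift ν ∨ blockOf b.src = (y.shift μ).shift ν) then X b else
    ⟨(((h b.src)⁻¹ : SU N) : Matrix (Fin N) (Fin N) ℂ) * ((Aref b.dir : (specialUnitaryLogChart (Fin N)).lie) : Matrix (Fin N) (Fin N) ℂ) * star (((h b.src)⁻¹ : SU N) : Matrix (Fin N) (Fin N) ℂ), conj_mem_lie ((h b.src)⁻¹) (Aref b.dir)⟩ with hXt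
  have hagree : ∀ b : PBond P j, (blockOf b.src = y ∨ blockOf b.src = y.shift μ ∨ blockOf b.src = y.shift ν ∨ blockOf b.src = (y.shift μ).shift ν) → X b = Xt b := fun b hb => by simp only [hXt, hb, if_true]
  have hαδ : α < deltaSU (Fin N) := by linarith [hρ.trans (innerRadius_le_deltaSU (N := N)), deltaSU_pos (n := Fin N)]
  have hsmall : ∀ c', Small (expMeanLogSU (n := Fin N)) U₀ c' := fun c' i => lt_of_le_of_lt (hα c' i) hαδ
  have hfour : ∀ b : PBond P j, (blockOf b.src = c.src ∨ blockOf b.src = c.tgt) → X b = Xt b := by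
    rcases hc with rfl | rfl | rfl | rfl <;> intro b hb
    · exact hagree b (by rcases hb with hb | hb; exact Or.inl hb; exact Or.inr (Or.inl hb))
    · exact hagree b (by rcases hb with hb | hb; exact Or.inr (Or.inl hb); exact Or.inr (Or.inr (Or.inr hb)))
    · exact hagree b (by
        rcases hb with hb | hb
        · exact Or.inr (Or.inr (Or.inl hb))
        · refine Or.inr (Or.inr (Or.inr ?_)); rw [hb]; exact (shift_shift_comm y μ ν).symm)
    · exact hagree b (by rcases hb with hb | hb; exact Or.inl hb; exact Or.inr (Or.inr (Or.inl hb)))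
  rw [chartRead_apply_local hj U₀ c hfour, fderiv_chartRead_apply_local hj U₀ hsmall c hfour]
  -- size of the truncation (polydisc for C₃)
  have hXtM : ‖Xt‖ ≤ M := by
    refine (pi_norm_le_iff_of_nonneg hM0).2 fun b => ?_
    by_cases hb : (blockOf b.src = y ∨ blockOf b.src = y.shift μ ∨ blockOf b.src = y.shift ν ∨ blockOf b.src = (y.shift μ).shift ν)
    · simp only [hXt, hb, if_true]; exact hXM b hb
    · simp only [hXt, hb, if_false]
      rw [← Submodule.norm_coe]
      exact (norm_coe_conj_le _ _).trans (by rw [Submodule.norm_coe]; exact (norm_le_pi_norm Aref b.dir).trans hAM)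
  have hXa : ‖Xt‖ ≤ a := by linarith
  have hXpoly : 100 * ((((P.d + 2) * P.L : ℕ) : ℝ) * (Real.exp ‖Xt‖ - 1)) ≤ ρ := by
    have hmono : Real.exp ‖Xt‖ - 1 ≤ Real.exp a - 1 := by linarith [Real.exp_le_exp.2 hXa]
    exact le_trans (by gcongr) ha
  -- pass to the four-block axial gauge (C₃: the remainder's norm is gauge invariant)
  rw [← norm_chartRead_sub_fderiv_gaugeAct h U₀ hj hρ0 hρ hα hα4 Xt c hXpoly]
  have hα' : ∀ c' i, dist1 (loopHol (GaugeField.gaugeAct h U₀) c' i) ≤ α := fun c' i => by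
    rw [dist1_loopHol_gaugeAct]; exact hα c' i
  have hκ : ∀ b : PBond P j, (blockOf b.src = c.src ∨ blockOf b.src = c.tgt) →
      ‖((GaugeField.gaugeAct h U₀ b : SU N) : Matrix (Fin N) (Fin N) ℂ) - 1‖ ≤ ((P.d - 1 : ℕ) : ℝ) * ((3 * P.L : ℕ) : ℝ) * δ := by
    have hcorner : ∀ b : PBond P j, (blockOf b.src = c.src ∨ blockOf b.src = c.tgt) → (blockOf b.src = y ∨ blockOf b.src = y.shift μ ∨ blockOf b.src = y.shift ν ∨ blockOf b.src = (y.shift μ).shift ν) := by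
      rcases hc with rfl | rfl | rfl | rfl <;> intro b hb
      · rcases hb with hb | hb; exact Or.inl hb; exact Or.inr (Or.inl hb)
      · rcases hb with hb | hb; exact Or.inr (Or.inl hb); exact Or.inr (Or.inr (Or.inr hb))
      · rcases hb with hb | hb
        · exact Or.inr (Or.inr (Or.inl hb))
        · refine Or.inr (Or.inr (Or.inr ?_)); rw [hb]; exact (shift_shift_comm y μ ν).symm
      · rcases hb with hb | hb; exact Or.inl hb; exact Or.inr (Or.inr (Or.inl hb))
    intro b hb
    rw [hh]; exact norm_coe_gaugeAct_axialGauge_sub_one_le_corner hj hj2 U₀ hδ hU y μ ν b (hcorner b hb)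
  -- the gauged truncation: `Ad_h X` on the corners, `Aref∘dir` outside
  have hgauge_off : ∀ b : PBond P j, ¬ (blockOf b.src = y ∨ blockOf b.src = y.shift μ ∨ blockOf b.src = y.shift ν ∨ blockOf b.src = (y.shift μ).shift ν) →
      ((h b.src : SU N) : Matrix (Fin N) (Fin N) ℂ) * ((Xt b : (specialUnitaryLogChart (Fin N)).lie) : Matrix (Fin N) (Fin N) ℂ) * star ((h b.src : SU N) : Matrix (Fin N) (Fin N) ℂ) = ((Aref b.dir : (specialUnitaryLogChart (Fin N)).lie) : Matrix (Fin N) (Fin N) ℂ) := fun b hb => by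
    simp only [hXt, hb, if_false, coe_inv_SU, star_star]
    rw [show ((h b.src : SU N) : Matrix (Fin N) (Fin N) ℂ) * (star ((h b.src : SU N) : Matrix (Fin N) (Fin N) ℂ) * ((Aref b.dir : (specialUnitaryLogChart (Fin N)).lie) : Matrix (Fin N) (Fin N) ℂ) * ((h b.src : SU N) : Matrix (Fin N) (Fin N) ℂ)) *
        star ((h b.src : SU N) : Matrix (Fin N) (Fin N) ℂ) = (((h b.src : SU N) : Matrix (Fin N) (Fin N) ℂ) * star ((h b.src : SU N) : Matrix (Fin N) (Fin N) ℂ)) * ((Aref b.dir : (specialUnitaryLogChart (Fin N)).lie) : Matrix (Fin N) (Fin N) ℂ) *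
        (((h b.src : SU N) : Matrix (Fin N) (Fin N) ℂ) * star ((h b.src : SU N) : Matrix (Fin N) (Fin N) ℂ)) by noncomm_ring, coe_mul_star_coe_SU, one_mul, mul_one]
  have hYO : ‖(fun b : PBond P j => (⟨((h b.src : SU N) : Matrix (Fin N) (Fin N) ℂ) * ((Xt b : (specialUnitaryLogChart (Fin N)).lie) : Matrix (Fin N) (Fin N) ℂ) * star ((h b.src : SU N) : Matrix (Fin N) (Fin N) ℂ), conj_mem_lie (h b.src) (Xt b)⟩ : (specialUnitaryLogChart (Fin N)).lie)) -
      (fun b => Aref b.dir)‖ ≤ O := by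
    refine (pi_norm_le_iff_of_nonneg hO0).2 fun b => ?_
    rw [Pi.sub_apply, ← Submodule.norm_coe, Submodule.coe_sub]
    by_cases hb : (blockOf b.src = y ∨ blockOf b.src = y.shift μ ∨ blockOf b.src = y.shift ν ∨ blockOf b.src = (y.shift μ).shift ν)
    · have := hXO b hb
      simp only [hXt, hb, if_true]
      exact this
    · have e := hgauge_off b hb
      dsimp only
      rw [e, sub_self, norm_zero]; exact hO0
  have hYM : ‖(fun b : PBond P j => (⟨((h b.src : SU N) : Matrix (Fin N) (Fin N) ℂ) * ((Xt b : (specialUnitaryLogChart (Fin N)).lie) : Matrix (Fin N) (Fin N) ℂ) * star ((h b.src : SU N) : Matrix (Fin N) (Fin N) ℂ), conj_mem_lie (h b.src) (Xt b)⟩ : (specialUnitaryLogChart (Fin N)).lie))‖ ≤ M := by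
    refine (pi_norm_le_iff_of_nonneg hM0).2 fun b => ?_
    rw [← Submodule.norm_coe]
    exact (norm_coe_conj_le (h b.src) _).trans (by rw [Submodule.norm_coe]; exact (norm_le_pi_norm Xt b).trans hXtM)
  have hAa : 8 * ‖Aref‖ ≤ a := by linarith
  have hXA : 8 * ‖(fun b : PBond P j => (⟨((h b.src : SU N) : Matrix (Fin N) (Fin N) ℂ) * ((Xt b : (specialUnitaryLogChart (Fin N)).lie) : Matrix (Fin N) (Fin N) ℂ) * star ((h b.src : SU N) : Matrix (Fin N) (Fin N) ℂ), conj_mem_lie (h b.src) (Xt b)⟩ : (specialUnitaryLogChart (Fin N)).lie)) -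
      (fun b => Aref b.dir)‖ ≤ a := by linarith
  have hC := norm_chartRead_sub_fderiv_le_curved_osc (GaugeField.gaugeAct h U₀) hj hρ0 hρ hα' hα4 hκℓ c hκ ha0 ha Aref hAa _ hXA
  refine hC.trans ?_
  -- monotonicity in the oscillation, the reference size and the datum size
  have hB0 : 0 ≤ 54 * ((((P.d + 2) * P.L : ℕ) : ℝ) * (Real.exp a - 1)) := by
    have : 0 ≤ Real.exp a - 1 := by linarith [Real.add_one_le_exp a]
    positivity
  have hMa' : M < a := by linarith
  have h1 := FluctuationComparisonRegPrIntLS2BetaChartReadOscSplit.cauchy_bound_mono (a := a) (nu := ‖Aref‖) (nu' := M) hB0 (norm_nonneg _) hYO hAM hMa'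
  have hB32 : 0 ≤ 32 * (54 * ((((P.d + 2) * P.L : ℕ) : ℝ) * (Real.exp a - 1))) := by linarith
  have h2 : 32 * (54 * ((((P.d + 2) * P.L : ℕ) : ℝ) * (Real.exp a - 1))) *
      ‖(fun b : PBond P j => (⟨((h b.src : SU N) : Matrix (Fin N) (Fin N) ℂ) * ((Xt b : (specialUnitaryLogChart (Fin N)).lie) : Matrix (Fin N) (Fin N) ℂ) * star ((h b.src : SU N) : Matrix (Fin N) (Fin N) ℂ), conj_mem_lie (h b.src) (Xt b)⟩ : (specialUnitaryLogChart (Fin N)).lie)) -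
        (fun b => Aref b.dir)‖ * ‖Aref‖ / a ^ 2 ≤
      32 * (54 * ((((P.d + 2) * P.L : ℕ) : ℝ) * (Real.exp a - 1))) * O * M / a ^ 2 := by
    refine div_le_div_of_nonneg_right ?_ (pow_pos ha0 2).le
    exact mul_le_mul (mul_le_mul_of_nonneg_left hYO hB32) hAM (norm_nonneg _) (mul_nonneg hB32 hO0)
  have h3 : ((((P.d + 2) * P.L : ℕ) : ℝ) * ‖Aref‖) ^ 3 ≤ ((((P.d + 2) * P.L : ℕ) : ℝ) * M) ^ 3 :=
    pow_le_pow_left₀ (by positivity) (mul_le_mul_of_nonneg_left hAM (Nat.cast_nonneg _)) 3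
  have h4 : 8 * (67 * ((((P.d + 2) * P.L : ℕ) : ℝ) * (((P.d - 1 : ℕ) : ℝ) * ((3 * P.L : ℕ) : ℝ) * δ))) *
      ‖(fun b : PBond P j => (⟨((h b.src : SU N) : Matrix (Fin N) (Fin N) ℂ) * ((Xt b : (specialUnitaryLogChart (Fin N)).lie) : Matrix (Fin N) (Fin N) ℂ) * star ((h b.src : SU N) : Matrix (Fin N) (Fin N) ℂ), conj_mem_lie (h b.src) (Xt b)⟩ : (specialUnitaryLogChart (Fin N)).lie))‖ ^ 2 / a ^ 2 ≤
      8 * (67 * ((((P.d + 2) * P.L : ℕ) : ℝ) * (((P.d - 1 : ℕ) : ℝ) * ((3 * P.L : ℕ) : ℝ) * δ))) * M ^ 2 / a ^ 2 :=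
    div_le_div_of_nonneg_right (mul_le_mul_of_nonneg_left (pow_le_pow_left₀ (norm_nonneg _) hYM 2) (by positivity)) (pow_pos ha0 2).le
  linarith

end OnePlaquette

/-! ## §3 ★ «R′-MONO»: the covariant formula is monotone in the oscillation, the size and the plaquette class -/

section Mono

omit [NeZero N] in
/-- ★ **«R′-MONO»**: `R′(O, M, δ) ≤ R′(O′, M′, δ′)` for `0 ≤ O ≤ O′`, `0 ≤ M ≤ M′ < a`, `0 ≤ δ ≤ δ′` (`0 < a`) — read-cell sups in one `exact` (RULING «SRC-VOL» (R-e)∕(R-f)). [folklore] -/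
theorem R'_mono {a O O' M M' δ δ' : ℝ} (ha0 : 0 < a) (hO0 : 0 ≤ O) (hOO : O ≤ O') (hM0 : 0 ≤ M) (hMM : M ≤ M') (hM'a : M' < a)
    (hδ0 : 0 ≤ δ) (hδδ : δ ≤ δ') :
    8 * (54 * ((((P.d + 2) * P.L : ℕ) : ℝ) * (Real.exp a - 1))) * O ^ 2 / (a - M) ^ 2 +
        32 * (54 * ((((P.d + 2) * P.L : ℕ) : ℝ) * (Real.exp a - 1))) * O * M / a ^ 2 +
        ((((P.d + 2) * P.L : ℕ) : ℝ) * M) ^ 3 + 8 * (67 * ((((P.d + 2) * P.L : ℕ) : ℝ) * (((P.d - 1 : ℕ) : ℝ) * ((3 * P.L : ℕ) : ℝ) * δ))) * M ^ 2 / a ^ 2 ≤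
      8 * (54 * ((((P.d + 2) * P.L : ℕ) : ℝ) * (Real.exp a - 1))) * O' ^ 2 / (a - M') ^ 2 +
        32 * (54 * ((((P.d + 2) * P.L : ℕ) : ℝ) * (Real.exp a - 1))) * O' * M' / a ^ 2 +
        ((((P.d + 2) * P.L : ℕ) : ℝ) * M') ^ 3 + 8 * (67 * ((((P.d + 2) * P.L : ℕ) : ℝ) * (((P.d - 1 : ℕ) : ℝ) * ((3 * P.L : ℕ) : ℝ) * δ'))) * M' ^ 2 / a ^ 2 := by
  have hB0 : 0 ≤ 54 * ((((P.d + 2) * P.L : ℕ) : ℝ) * (Real.exp a - 1)) := by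
    have : 0 ≤ Real.exp a - 1 := by linarith [Real.add_one_le_exp a]
    positivity
  have hM'0 : 0 ≤ M' := hM0.trans hMM
  have hO'0 : 0 ≤ O' := hO0.trans hOO
  have h1 := FluctuationComparisonRegPrIntLS2BetaChartReadOscSplit.cauchy_bound_mono (a := a) (nu := M) (nu' := M') hB0 hO0 hOO hMM hM'a
  have hB32 : 0 ≤ 32 * (54 * ((((P.d + 2) * P.L : ℕ) : ℝ) * (Real.exp a - 1))) := by linarith
  have h2 : 32 * (54 * ((((P.d + 2) * P.L : ℕ) : ℝ) * (Real.exp a - 1))) * O * M / a ^ 2 ≤ 32 * (54 * ((((P.d + 2) * P.L : ℕ) : ℝ) * (Real.exp a - 1))) * O' * M' / a ^ 2 := by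
    refine div_le_div_of_nonneg_right ?_ (pow_pos ha0 2).le
    exact mul_le_mul (mul_le_mul_of_nonneg_left hOO hB32) hMM hM0 (mul_nonneg hB32 hO'0)
  have h3 : ((((P.d + 2) * P.L : ℕ) : ℝ) * M) ^ 3 ≤ ((((P.d + 2) * P.L : ℕ) : ℝ) * M') ^ 3 :=
    pow_le_pow_left₀ (by positivity) (mul_le_mul_of_nonneg_left hMM (Nat.cast_nonneg _)) 3
  have h4 : 8 * (67 * ((((P.d + 2) * P.L : ℕ) : ℝ) * (((P.d - 1 : ℕ) : ℝ) * ((3 * P.L : ℕ) : ℝ) * δ))) * M ^ 2 / a ^ 2 ≤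
      8 * (67 * ((((P.d + 2) * P.L : ℕ) : ℝ) * (((P.d - 1 : ℕ) : ℝ) * ((3 * P.L : ℕ) : ℝ) * δ'))) * M' ^ 2 / a ^ 2 := by
    refine div_le_div_of_nonneg_right ?_ (pow_pos ha0 2).le
    have hδ'0 : 0 ≤ δ' := hδ0.trans hδδ
    have hδc : 8 * (67 * ((((P.d + 2) * P.L : ℕ) : ℝ) * (((P.d - 1 : ℕ) : ℝ) * ((3 * P.L : ℕ) : ℝ) * δ))) ≤ 8 * (67 * ((((P.d + 2) * P.L : ℕ) : ℝ) * (((P.d - 1 : ℕ) : ℝ) * ((3 * P.L : ℕ) : ℝ) * δ'))) := by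
      gcongr
    exact mul_le_mul hδc (pow_le_pow_left₀ hM0 hMM 2) (by positivity) (by positivity)
  linarith

end Mono

end Summit.QuantumFields.YangMills.Theorems.FluctuationComparisonRegPrIntLS2BetaCoarseCurlRemainderCovariant

end
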